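import Summits.BirchSwinnertonDyer.Rank1Residual.AdditivePotMult.PotMultRankOneWuthrichCertificate
import Summits.BirchSwinnertonDyer.Rank1Residual.AdditivePotMult.PotMultChiBranchPrimePrep
import Summits.BirchSwinnertonDyer.Rank1Residual.AdditivePotMult.Twist
import Summits.BirchSwinnertonDyer.Rank1Residual.Additive.SemistableTwistAnalytic
import Summits.BirchSwinnertonDyer.Rank1Residual.Additive.SemistableTwistAnalyticOdd
import Summits.BirchSwinnertonDyer.Rank1Residual.Additive.ChiBranchLowerTransportPotMult
import Summits.BirchSwinnertonDyer.Rank1Residual.Additive.CycLeadingTermDvdConverse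
import Summits.BirchSwinnertonDyer.Rank1Residual.Additive.CycLeadingTermDvdIff
import Literature.NumberTheory.EllipticCurves.LeadingTermPPartProofs
import HarnessLib

/-!
# Route `AdditiveBranchIMC` (rung K1), crux `MultLower` (item `stmt-BirchSwinnertonDyer-19359`):
# the rank-0 Λ-adic upgrade on the REDUCIBLE rows X3♯(M) — no image hypothesis at all

Cell `bsd-addord`, seat `bsd-addord-k1-c4` (gen 2). Sibling of `AdditiveBranchIMCMultLowerLambdaAdic{,Odd}.lean`
(X4(M), tower-surjective): the same elementary upgrade with Kato's half-eigen reading replaced by Wuthrich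
2014 Thm. 16 read on the `ω^{(p−1)/2}`-component (`hW16`, the tree's READING fact
`Wuthrich2014.thm16_halfEigenCharIdeal_dvd_cyclotomicPrime`, brick
`AdditivePotMult.isTorsion_and_exists_iota_eq_of_wuthrichHalf`), which needs `V[p]` REDUCIBLE instead of a
big image. HONEST FRAMING: every published input is a named-fact binder (`hW16`, `hPal`, `hmod`, `hDel`,
`hDelX`, `hGZK`, `hmodD`); the LOWER input stays displayed; nothing asserted about any curve; nothing
booked; cell (M) stays CONSTRUCTION-shaped. For reducible `V[p]` the cell's Λ-adic object of record is
`X3BranchMainConjectureAt` (lattice / `μ` caveat of b2b p10); the statements below are about the Néron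
lattice datum `Sel_{p^∞}(E/ℚ_∞)` as typed and are conditional both ways. THEOREMS ONLY.

* §1 even / §2 odd: `charIdeal_eq_span_wuthrich_of_chiBranchLowerLeadingTerm[Odd]_rankZero_mult_red` —
  on an X3♯(M) pair in analytic rank `0`, the `T = 0` lower input + `hW16` + Birch–Pal ⟹
  `char_Λ X(E/ℚ_∞) = (g_W)`, `ι g_W = u·ϖ·L^±_p(f_V, ±1, ω^{(p−1)/2}, T)` at every multiplicative twist datum.
* §3 `missingLowerBoundAt_iff_chiBranchLowerLeadingTerm[Odd]At_classX3M_rankZero` (`p ≥ 5`) and the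
  upgrade from the crux's OWN conclusion `charIdeal_eq_span_wuthrich_of_missingLowerBoundAt_rankZero_mult_red[_odd]`.

So on X3♯(M) ∩ `r_an = 0` ∩ `p ≥ 5` too the crux, its `T = 0` input and the branch MC are ONE statement.
References: [Wuthrich2014] Thm. 16, §3; [MazurTateTeitelbaum1986Invent] §I.13–I.14; [Pal2012] Thm. 3.2;
[Delbourgo1998] Prop. 4; [Washington1997] §13.2.
-/

set_option autoImplicit false
set_option linter.dupNamespace false

noncomputable section

open scoped Classical MatrixGroups ModularForm

open CongruenceSubgroup WeierstrassCurve NumberField IsDedekindDomain Rat.HeightOneSpectrum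
  Literature.NumberTheory.EllipticCurves
  Literature.NumberTheory.EllipticCurves.ModularForms
  Literature.NumberTheory.EllipticCurves.Rank1Residual
  Literature.NumberTheory.EllipticCurves.Rank1Residual.Typed
  Literature.NumberTheory.GaloisRepresentations

namespace Summit.BirchSwinnertonDyer.BirchSwinnertonDyer.Theorems.AdditiveBranchIMCMultLowerLambdaAdic

open Summit.BirchSwinnertonDyer.Rank1Residual.Additive
open Summit.BirchSwinnertonDyer.Rank1Residual.AdditivePotMult

variable {W : WeierstrassCurve ℚ} [W.IsElliptic] [W.IsGloballyMinimal] {p : ℕ} [hp : Fact p.Prime]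

/-! ## §1 Even branch, reducible rows -/

/-- **The full main conjecture on the `ω^{(p−1)/2}`-branch from the `T = 0` lower input, analytic rank
`0`, cell (M), even branch** (per datum). `W = E` globally minimal, additive at `p ≡ 1 (mod 4)`,
`ord_{s=1} L(E,s) = 0`, `E[p]` REDUCIBLE (X3♯(M) rows); `(V, f, ϖ)` a MULTIPLICATIVE twist datum
(`C • V^{(p)} = W`, `V` multiplicative at `p`, `ϖ·Ω_V = Ω⁺_f`), `D` a dual datum of `Sel_{p^∞}(E/ℚ_∞)`.
IF `ChiBranchLowerLeadingTermAt W p` holds, then `char_Λ X(E/ℚ_∞) = (g_K)` with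
`ι g_K = u·ϖ·L⁺_p(f, a_p, ω^{(p−1)/2}, T)` (`a_p = ±1` the split/non-split sign), `u ∈ ℤ_p^×`.
Inputs by name: Wuthrich 2014 Thm. 16 half-eigen reading `hW16`, Pal `hPal` + modularity `hmod` (Birch: `ϖ S ≠ 0` in rank
`0`), principality of `char_Λ`. [cite: Wuthrich2014, Thm. 16 (p. 397), §3 (p. 390)] [cite: MazurTateTeitelbaum1986Invent, §I.14]
[cite: Pal2012, Thm. 3.2] [cite: Washington1997, §13.2] -/
theorem charIdeal_eq_span_wuthrich_of_chiBranchLowerLeadingTerm_rankZero_mult_red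
    (hW16 : Wuthrich2014.thm16_halfEigenCharIdeal_dvd_cyclotomicPrime)
    (hPal : Pal2012.thm32_sqrt_mul_realPeriodRat_twist_eq_of_prime_one_mod_four)
    (hmod : hasEntireLFunction_rat)
    (hadd : Addv W p) (hr : W.analyticRank = 0)
    (hred : ¬ Irr W p)
    (hLow : ChiBranchLowerLeadingTermAt W p)
    (V : WeierstrassCurve ℚ) [V.IsElliptic] [V.IsGloballyMinimal]
    {κ : ZpExtension ℚ p} {γ : Field.absoluteGaloisGroup ℚ} {N : ℕ} [NeZero N]
    {f : CuspForm (Gamma0 N) 2} (hp1 : p % 4 = 1)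
    (hCW : ∃ C : VariableChange ℚ, C • V.quadraticTwist (p : ℚ) = W) (hV : Mult V p)
    (hκ : κ.IsCyclotomic) (hγ : κ.IsTopGenerator γ) (hcv : IsCyclotomicVariable p γ)
    (hf : IsNewformOf V f) (D : W.SelmerDualData κ γ) (ϖ : ℚ)
    (hϖ : (ϖ : ℝ) * V.realPeriodRat = plusPeriod f) :
    ∃ (B : PowerSeries ℚ_[p]) (e : ℤ_[p]ˣ),
      ((V.HasSplitMultiplicativeReductionAtPrime p ∧
          B = padicLFunctionPlusBranchMult f (1 : ℚ_[p]) (p / 2)) ∨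
        (¬ V.HasSplitMultiplicativeReductionAtPrime p ∧
          B = padicLFunctionPlusBranchMult f (-1 : ℚ_[p]) (p / 2))) ∧
      PowerSeries.constantCoeff B = ((e : ℤ_[p]) : ℚ_[p]) * (legendrePlusSymbolSum f p : ℚ_[p]) ∧
      ∃ gK ∈ D.charIdeal, ∃ u : ℤ_[p]ˣ, D.charIdeal = Ideal.span {gK} ∧
        iwasawaToPowerSeries p gK = PowerSeries.C (((u : ℤ_[p]) : ℚ_[p]) * (ϖ : ℚ_[p])) * B := by
  have hp2 : p ≠ 2 := by rintro rfl; norm_num at hp1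
  have hpne : (p : ℚ) ≠ 0 := Nat.cast_ne_zero.mpr hp.out.ne_zero
  have heven : Even (p / 2) := ⟨p / 4, by omega⟩
  -- `V[p]` is reducible iff `E[p]` is (twisting by `χ_{p*}`)
  have hredV : ¬ V.HasIrreducibleModPGaloisRep p := fun h ↦
    hred ((irr_iff_of_model_twist (W := V) hpne hCW).mpr h)
  -- the branch series of the reduction type, with its constant term
  obtain ⟨B, e, hdisj, hB0⟩ := exists_halfBranchMult_even p hp2 heven hV hf
  obtain ⟨C, hC⟩ := hCW
  have hC' : C • V.quadraticTwist ((-1 : ℚ) ^ (p / 2) * p) = W := by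
    rw [Even.neg_one_pow heven, one_mul]; exact hC
  -- Kato's element, Λ-adically, on the branch
  have hϖ' : (if Even (p / 2) then (ϖ : ℝ) * V.realPeriodRat = plusPeriod f
      else (ϖ : ℝ) * V.imaginaryPeriodRat = minusPeriod f) := by
    rw [if_pos heven]; exact hϖ
  obtain ⟨-, gK, hgK, u, hιgK⟩ :=
    isTorsion_and_exists_iota_eq_of_wuthrichHalf hW16 hp2 V C hC' hredV hκ hγ hcv hf D B hdisj ϖ hϖ'
  -- record the shape of `B` (no good ordinary case: `V` is multiplicative)
  have hnotord : ¬ IsOrdinaryAt V p := fun h ↦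
    (WeierstrassCurve.HasGoodReduction.not_hasMultiplicativeReduction (R := ℤ_[p]) h.1) hV
  have hBshape : (V.HasSplitMultiplicativeReductionAtPrime p ∧
        B = padicLFunctionPlusBranchMult f (1 : ℚ_[p]) (p / 2)) ∨
      (¬ V.HasSplitMultiplicativeReductionAtPrime p ∧
        B = padicLFunctionPlusBranchMult f (-1 : ℚ_[p]) (p / 2)) := by
    rcases hdisj with ⟨hord, -⟩ | ⟨hs, hB⟩ | ⟨-, hns, hB⟩
    · exact absurd hord hnotord
    · exact Or.inl ⟨hs, by rw [hB, if_pos heven]⟩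
    · exact Or.inr ⟨hns, by rw [hB, if_pos heven]⟩
  refine ⟨B, e, hBshape, hB0, ?_⟩
  -- a generator `f₁` of `char X`
  haveI : (Module.charIdeal (IwasawaAlgebra p) D.X).IsPrincipal := charIdeal_isPrincipal_holds p D.X
  obtain ⟨f₁, hf₁⟩ := Submodule.IsPrincipal.principal (Module.charIdeal (IwasawaAlgebra p) D.X)
  have hf₁mem : f₁ ∈ D.charIdeal := by
    change f₁ ∈ Module.charIdeal (IwasawaAlgebra p) D.X
    rw [hf₁]
    exact Ideal.mem_span_singleton_self f₁
  -- the `T = 0` lower input at `f₁`: `f₁(0) = c·ϖ·S`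
  obtain ⟨c, hc⟩ := hLow V hp1 ⟨C, hC⟩ (Or.inr hV) hκ hγ hcv hf D ϖ hϖ f₁ hf₁mem
  -- `gK = h · f₁`
  have hgK' : gK ∈ Ideal.span {f₁} := by
    change gK ∈ Module.charIdeal (IwasawaAlgebra p) D.X at hgK
    rwa [hf₁] at hgK
  obtain ⟨h, hh⟩ := Ideal.mem_span_singleton'.mp hgK'
  -- constant terms: `gK(0) = u ϖ e S` and `gK(0) = h(0) f₁(0) = h(0) c ϖ S`
  have h0 := congrArg PowerSeries.constantCoeff hιgK
  rw [constantCoeff_iwasawaToPowerSeries, map_mul, PowerSeries.constantCoeff_C, hB0] at h0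
  have hprod : ((PowerSeries.constantCoeff gK : ℤ_[p]) : ℚ_[p]) =
      ((PowerSeries.constantCoeff h : ℤ_[p]) : ℚ_[p]) *
        ((PowerSeries.constantCoeff f₁ : ℤ_[p]) : ℚ_[p]) := by
    rw [← hh, map_mul, PadicInt.coe_mul]
  -- `ϖ S ≠ 0` in rank `0` (Birch + Pal: `L(E,1) = ±ϖ S Ω_E`)
  have hϖS : (ϖ : ℚ_[p]) * (legendrePlusSymbolSum f p : ℚ_[p]) ≠ 0 := by
    obtain ⟨ε, -, hL⟩ :=
      entireLFunction_one_eq_of_twist p hPal hmod hp1 V W ⟨C, hC⟩ (Or.inr hV) hadd hf ϖ hϖ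
    have hL0 : W.entireLFunction 1 ≠ 0 := (W.analyticRank_eq_zero_iff_holds (hmod W)).mp hr
    have hq : (ϖ * legendrePlusSymbolSum f p : ℚ) ≠ 0 := by
      intro hz
      apply hL0
      rw [hL, hz, mul_zero, Rat.cast_zero, zero_mul]
    have hq' : ((ϖ * legendrePlusSymbolSum f p : ℚ) : ℚ_[p]) ≠ 0 := by exact_mod_cast hq
    simpa [Rat.cast_mul] using hq'
  -- hence `h(0)·c = u·e`, a unit of `ℤ_p`
  have hkey : ((PowerSeries.constantCoeff h : ℤ_[p]) : ℚ_[p]) * (c : ℚ_[p]) =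
      ((u : ℤ_[p]) : ℚ_[p]) * ((e : ℤ_[p]) : ℚ_[p]) := by
    have e1 : ((PowerSeries.constantCoeff h : ℤ_[p]) : ℚ_[p]) * (c : ℚ_[p]) *
        ((ϖ : ℚ_[p]) * (legendrePlusSymbolSum f p : ℚ_[p])) =
        ((u : ℤ_[p]) : ℚ_[p]) * ((e : ℤ_[p]) : ℚ_[p]) *
          ((ϖ : ℚ_[p]) * (legendrePlusSymbolSum f p : ℚ_[p])) := by
      have e2 := h0
      rw [hprod, hc] at e2
      -- e2 : h(0) * (c * ϖ * S) = u * ϖ * (e * S)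
      linear_combination e2
    exact mul_right_cancel₀ hϖS e1
  have hunitZ : IsUnit (PowerSeries.constantCoeff h * c) := by
    have hcoe : (((PowerSeries.constantCoeff h * c : ℤ_[p])) : ℚ_[p]) =
        (((u * e : ℤ_[p]ˣ) : ℤ_[p]) : ℚ_[p]) := by
      rw [PadicInt.coe_mul, hkey, Units.val_mul, PadicInt.coe_mul]
    have heq : PowerSeries.constantCoeff h * c = ((u * e : ℤ_[p]ˣ) : ℤ_[p]) := PadicInt.ext hcoe
    rw [heq]
    exact Units.isUnit _
  have hunit_h : IsUnit h :=
    (PowerSeries.isUnit_iff_constantCoeff (φ := h)).mpr (isUnit_of_mul_isUnit_left hunitZ)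
  -- so `(f₁) = (gK)`
  have hspan : Ideal.span {f₁} = Ideal.span ({gK} : Set (IwasawaAlgebra p)) := by
    rw [← hh]
    exact (Ideal.span_singleton_mul_left_unit hunit_h f₁).symm
  refine ⟨gK, hgK, u, ?_, hιgK⟩
  change Module.charIdeal (IwasawaAlgebra p) D.X = _
  rw [hf₁]
  exact hspan

/-! ## §2 Odd branch, reducible rows -/

/-- **The full main conjecture on the `ω^{(p−1)/2}`-branch from the `T = 0` lower input, analytic rank
`0`, cell (M), ODD branch** (per datum). `W = E` globally minimal, additive at `p ≡ 3 (mod 4)`,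
`ord_{s=1} L(E,s) = 0`, `E[p]` REDUCIBLE (X3♯(M) rows); `(V, f, ϖ⁻)` a MULTIPLICATIVE twist datum
(`C • V^{(−p)} = W`, `ϖ⁻·|Ω⁻(V)| = Ω⁻_f`), `D` a dual datum at a cyclotomic `κ/γ`. IF
`ChiBranchLowerLeadingTermOddAt W p` holds, then `char_Λ X(E/ℚ_∞) = (g_K)` with
`ι g_K = u·ϖ⁻·L⁻_p(f, a_p, ω^{(p−1)/2}, T)`, `u ∈ ℤ_p^×`. Inputs by name: Wuthrich 2014 Thm. 16 half-eigen reading `hW16`,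
modularity `hmod` (odd Birch: `L(E,1) = ±ϖ⁻ S⁻ Ω_E/(|u| c_∞)`, so `ϖ⁻ S⁻ ≠ 0` in rank `0`),
principality of `char_Λ`. [cite: Wuthrich2014, Thm. 16 (p. 397), §3 (p. 390)] [cite: MazurTateTeitelbaum1986Invent, §I.14]
[cite: Washington1997, §13.2] -/
theorem charIdeal_eq_span_wuthrich_of_chiBranchLowerLeadingTermOdd_rankZero_mult_red
    (hW16 : Wuthrich2014.thm16_halfEigenCharIdeal_dvd_cyclotomicPrime)
    (hmod : hasEntireLFunction_rat)
    (hadd : Addv W p) (hr : W.analyticRank = 0)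
    (hred : ¬ Irr W p)
    (hLow : ChiBranchLowerLeadingTermOddAt W p)
    (V : WeierstrassCurve ℚ) [V.IsElliptic] [V.IsGloballyMinimal]
    {κ : ZpExtension ℚ p} {γ : Field.absoluteGaloisGroup ℚ} {N : ℕ} [NeZero N]
    {f : CuspForm (Gamma0 N) 2} (hp3 : p % 4 = 3)
    (hCW : ∃ C : VariableChange ℚ, C • V.quadraticTwist (-(p : ℚ)) = W) (hV : Mult V p)
    (hκ : κ.IsCyclotomic) (hγ : κ.IsTopGenerator γ) (hcv : IsCyclotomicVariable p γ)
    (hf : IsNewformOf V f) (D : W.SelmerDualData κ γ) (ϖ : ℚ)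
    (hϖ : (ϖ : ℝ) * V.imaginaryPeriodRat = minusPeriod f) :
    ∃ (B : PowerSeries ℚ_[p]) (e : ℤ_[p]ˣ),
      ((V.HasSplitMultiplicativeReductionAtPrime p ∧
          B = padicLFunctionMinusBranchMult f (1 : ℚ_[p]) (p / 2)) ∨
        (¬ V.HasSplitMultiplicativeReductionAtPrime p ∧
          B = padicLFunctionMinusBranchMult f (-1 : ℚ_[p]) (p / 2))) ∧
      PowerSeries.constantCoeff B = ((e : ℤ_[p]) : ℚ_[p]) * (legendreMinusSymbolSum f p : ℚ_[p]) ∧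
      ∃ gK ∈ D.charIdeal, ∃ u : ℤ_[p]ˣ, D.charIdeal = Ideal.span {gK} ∧
        iwasawaToPowerSeries p gK = PowerSeries.C (((u : ℤ_[p]) : ℚ_[p]) * (ϖ : ℚ_[p])) * B := by
  have hp2 : p ≠ 2 := by rintro rfl; norm_num at hp3
  have hpne : (-(p : ℚ)) ≠ 0 := neg_ne_zero.mpr (Nat.cast_ne_zero.mpr hp.out.ne_zero)
  have hodd : ¬ Even (p / 2) := by rw [Nat.not_even_iff_odd]; exact ⟨p / 4, by omega⟩
  have hodd' : Odd (p / 2) := ⟨p / 4, by omega⟩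
  -- `V[p]` is reducible iff `E[p]` is (twisting by `χ_{p*}`)
  have hredV : ¬ V.HasIrreducibleModPGaloisRep p := fun h ↦
    hred ((irr_iff_of_model_twist (W := V) hpne hCW).mpr h)
  -- the branch series of the reduction type, with its constant term
  obtain ⟨B, e, hdisj, hB0⟩ := exists_halfBranchMult_odd p hp2 hodd hV hf
  obtain ⟨C, hC⟩ := hCW
  have hC' : C • V.quadraticTwist ((-1 : ℚ) ^ (p / 2) * p) = W := by
    rw [Odd.neg_one_pow hodd', neg_one_mul]; exact hC
  -- Kato's element, Λ-adically, on the branch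
  have hϖ' : (if Even (p / 2) then (ϖ : ℝ) * V.realPeriodRat = plusPeriod f
      else (ϖ : ℝ) * V.imaginaryPeriodRat = minusPeriod f) := by
    rw [if_neg hodd]; exact hϖ
  obtain ⟨-, gK, hgK, u, hιgK⟩ :=
    isTorsion_and_exists_iota_eq_of_wuthrichHalf hW16 hp2 V C hC' hredV hκ hγ hcv hf D B hdisj ϖ hϖ'
  have hnotord : ¬ IsOrdinaryAt V p := fun h ↦
    (WeierstrassCurve.HasGoodReduction.not_hasMultiplicativeReduction (R := ℤ_[p]) h.1) hV
  have hBshape : (V.HasSplitMultiplicativeReductionAtPrime p ∧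
        B = padicLFunctionMinusBranchMult f (1 : ℚ_[p]) (p / 2)) ∨
      (¬ V.HasSplitMultiplicativeReductionAtPrime p ∧
        B = padicLFunctionMinusBranchMult f (-1 : ℚ_[p]) (p / 2)) := by
    rcases hdisj with ⟨hord, -⟩ | ⟨hs, hB⟩ | ⟨-, hns, hB⟩
    · exact absurd hord hnotord
    · exact Or.inl ⟨hs, by rw [hB, if_neg hodd]⟩
    · exact Or.inr ⟨hns, by rw [hB, if_neg hodd]⟩
  refine ⟨B, e, hBshape, hB0, ?_⟩
  -- a generator `f₁` of `char X`
  haveI : (Module.charIdeal (IwasawaAlgebra p) D.X).IsPrincipal := charIdeal_isPrincipal_holds p D.X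
  obtain ⟨f₁, hf₁⟩ := Submodule.IsPrincipal.principal (Module.charIdeal (IwasawaAlgebra p) D.X)
  have hf₁mem : f₁ ∈ D.charIdeal := by
    change f₁ ∈ Module.charIdeal (IwasawaAlgebra p) D.X
    rw [hf₁]
    exact Ideal.mem_span_singleton_self f₁
  -- the `T = 0` lower input at `f₁`: `f₁(0) = c·ϖ⁻·S⁻`
  obtain ⟨c, hc⟩ := hLow V hp3 ⟨C, hC⟩ (Or.inr hV) hκ hγ hcv hf D ϖ hϖ f₁ hf₁mem
  -- `gK = h · f₁`
  have hgK' : gK ∈ Ideal.span {f₁} := by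
    change gK ∈ Module.charIdeal (IwasawaAlgebra p) D.X at hgK
    rwa [hf₁] at hgK
  obtain ⟨h, hh⟩ := Ideal.mem_span_singleton'.mp hgK'
  -- constant terms
  have h0 := congrArg PowerSeries.constantCoeff hιgK
  rw [constantCoeff_iwasawaToPowerSeries, map_mul, PowerSeries.constantCoeff_C, hB0] at h0
  have hprod : ((PowerSeries.constantCoeff gK : ℤ_[p]) : ℚ_[p]) =
      ((PowerSeries.constantCoeff h : ℤ_[p]) : ℚ_[p]) *
        ((PowerSeries.constantCoeff f₁ : ℤ_[p]) : ℚ_[p]) := by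
    rw [← hh, map_mul, PadicInt.coe_mul]
  -- `ϖ⁻ S⁻ ≠ 0` in rank `0` (odd Birch)
  have hϖS : (ϖ : ℚ_[p]) * (legendreMinusSymbolSum f p : ℚ_[p]) ≠ 0 := by
    obtain ⟨ε, -, hL⟩ := entireLFunction_one_eq_of_twist_neg p hmod hp3 V W C hC hadd hf ϖ hϖ
    have hL0 : W.entireLFunction 1 ≠ 0 := (W.analyticRank_eq_zero_iff_holds (hmod W)).mp hr
    have hq : (ϖ * legendreMinusSymbolSum f p : ℚ) ≠ 0 := by
      intro hz
      apply hL0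
      rw [hL, hz, mul_zero, zero_div, Rat.cast_zero, zero_mul]
    have hq' : ((ϖ * legendreMinusSymbolSum f p : ℚ) : ℚ_[p]) ≠ 0 := by exact_mod_cast hq
    simpa [Rat.cast_mul] using hq'
  -- hence `h(0)·c = u·e`, a unit of `ℤ_p`
  have hkey : ((PowerSeries.constantCoeff h : ℤ_[p]) : ℚ_[p]) * (c : ℚ_[p]) =
      ((u : ℤ_[p]) : ℚ_[p]) * ((e : ℤ_[p]) : ℚ_[p]) := by
    have e1 : ((PowerSeries.constantCoeff h : ℤ_[p]) : ℚ_[p]) * (c : ℚ_[p]) *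
        ((ϖ : ℚ_[p]) * (legendreMinusSymbolSum f p : ℚ_[p])) =
        ((u : ℤ_[p]) : ℚ_[p]) * ((e : ℤ_[p]) : ℚ_[p]) *
          ((ϖ : ℚ_[p]) * (legendreMinusSymbolSum f p : ℚ_[p])) := by
      have e2 := h0
      rw [hprod, hc] at e2
      linear_combination e2
    exact mul_right_cancel₀ hϖS e1
  have hunitZ : IsUnit (PowerSeries.constantCoeff h * c) := by
    have hcoe : (((PowerSeries.constantCoeff h * c : ℤ_[p])) : ℚ_[p]) =
        (((u * e : ℤ_[p]ˣ) : ℤ_[p]) : ℚ_[p]) := by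
      rw [PadicInt.coe_mul, hkey, Units.val_mul, PadicInt.coe_mul]
    have heq : PowerSeries.constantCoeff h * c = ((u * e : ℤ_[p]ˣ) : ℤ_[p]) := PadicInt.ext hcoe
    rw [heq]
    exact Units.isUnit _
  have hunit_h : IsUnit h :=
    (PowerSeries.isUnit_iff_constantCoeff (φ := h)).mpr (isUnit_of_mul_isUnit_left hunitZ)
  have hspan : Ideal.span {f₁} = Ideal.span ({gK} : Set (IwasawaAlgebra p)) := by
    rw [← hh]
    exact (Ideal.span_singleton_mul_left_unit hunit_h f₁).symm
  refine ⟨gK, hgK, u, ?_, hιgK⟩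
  change Module.charIdeal (IwasawaAlgebra p) D.X = _
  rw [hf₁]
  exact hspan

/-! ## §3 X3♯(M), `p ≥ 5`: Miller ⟺ `T = 0`, and the upgrade from the crux's own conclusion -/

/-- **X3♯(M), `r_an = 0`, `p ≥ 5`, `p ≡ 1 (mod 4)`: `MissingLowerBoundAt W p ↔ ChiBranchLowerLeadingTermAt W p`**
(composition of the tree's `T = 0` iffs on the (M) locus). Bookkeeping.
[cite: Delbourgo1998, Prop. 4 (p. 144), §2.2 Lemma (ii) (p. 139)] [cite: Pal2012, Thm. 3.2] [cite: Miller2011LMS, Def. 1.1] -/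
theorem missingLowerBoundAt_iff_chiBranchLowerLeadingTermAt_classX3M_rankZero
    (hDel : Delbourgo1998.prop4_rankZero_pow_dvd_constantCoeff)
    (hDelX : Delbourgo1998.prop4_rankZero_constantCoeff_eq_unit_mul_of_potMult)
    (hPal : Pal2012.thm32_sqrt_mul_realPeriodRat_twist_eq_of_prime_one_mod_four)
    (hGZK : rank_eq_analyticRank_of_analyticRank_le_one) (hmod : hasEntireLFunction_rat)
    (hmodD : nonempty_modularParametrizationData)
    (hX : ClassX3M W p) (hp5 : 5 ≤ p) (hp1 : p % 4 = 1) (hr : W.analyticRank = 0) :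
    MissingLowerBoundAt W p ↔ ChiBranchLowerLeadingTermAt W p :=
  (missingLowerBoundAt_iff_cycLeadingTermDvdAt_of_potMult_of_five_le W p hDel hDelX hGZK hmod hp5 hX.1.2
      hX.2.1.2 hr).trans
    ((cycLeadingTermDvdAt_iff_cycLowerLeadingTermAt W p).trans
      (ClassX3M.cycLowerLeadingTermAt_iff_chiBranchLower hPal hmod hmodD hX hp1))

/-- **Odd-parity twin**: X3♯(M), `r_an = 0`, `p ≥ 5`, `p ≡ 3 (mod 4)`: Miller ⟺ `T = 0` odd input.
[cite: Delbourgo1998, Prop. 4 (p. 144), §2.2 Lemma (ii) (p. 139)] [cite: Miller2011LMS, Def. 1.1] -/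
theorem missingLowerBoundAt_iff_chiBranchLowerLeadingTermOddAt_classX3M_rankZero
    (hDel : Delbourgo1998.prop4_rankZero_pow_dvd_constantCoeff)
    (hDelX : Delbourgo1998.prop4_rankZero_constantCoeff_eq_unit_mul_of_potMult)
    (hGZK : rank_eq_analyticRank_of_analyticRank_le_one) (hmod : hasEntireLFunction_rat)
    (hmodD : nonempty_modularParametrizationData)
    (hX : ClassX3M W p) (hp5 : 5 ≤ p) (hp3 : p % 4 = 3) (hr : W.analyticRank = 0) :
    MissingLowerBoundAt W p ↔ ChiBranchLowerLeadingTermOddAt W p :=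
  (missingLowerBoundAt_iff_cycLeadingTermDvdAt_of_potMult_of_five_le W p hDel hDelX hGZK hmod hp5 hX.1.2
      hX.2.1.2 hr).trans
    ((cycLeadingTermDvdAt_iff_cycLowerLeadingTermAt W p).trans
      (ClassX3M.cycLowerLeadingTermAt_iff_chiBranchLowerOdd hmod hmodD hX hp3))

/-- **From the crux's own conclusion, X3♯(M), even branch**: `MissingLowerBoundAt W p` on an X3♯(M) pair
(`p ≥ 5`, `p ≡ 1 (mod 4)`, `r_an = 0`) gives the FULL branch main conjecture `char_Λ X(E/ℚ_∞) = (g_W)`,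
`ι g_W = u·ϖ·L⁺_p(f, a_p, ω^{(p−1)/2}, T)`, at every multiplicative twist datum — no image hypothesis.
[cite: Wuthrich2014, Thm. 16 (p. 397)] [cite: Delbourgo1998, Prop. 4 (p. 144)] [cite: Pal2012, Thm. 3.2]
[cite: Miller2011LMS, Def. 1.1] -/
theorem charIdeal_eq_span_wuthrich_of_missingLowerBoundAt_rankZero_mult_red
    (hW16 : Wuthrich2014.thm16_halfEigenCharIdeal_dvd_cyclotomicPrime)
    (hDel : Delbourgo1998.prop4_rankZero_pow_dvd_constantCoeff)
    (hDelX : Delbourgo1998.prop4_rankZero_constantCoeff_eq_unit_mul_of_potMult)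
    (hPal : Pal2012.thm32_sqrt_mul_realPeriodRat_twist_eq_of_prime_one_mod_four)
    (hGZK : rank_eq_analyticRank_of_analyticRank_le_one) (hmod : hasEntireLFunction_rat)
    (hmodD : nonempty_modularParametrizationData)
    (hX : ClassX3M W p) (hp5 : 5 ≤ p) (hp1 : p % 4 = 1) (hr : W.analyticRank = 0)
    (hlow : MissingLowerBoundAt W p)
    (V : WeierstrassCurve ℚ) [V.IsElliptic] [V.IsGloballyMinimal]
    {κ : ZpExtension ℚ p} {γ : Field.absoluteGaloisGroup ℚ} {N : ℕ} [NeZero N]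
    {f : CuspForm (Gamma0 N) 2}
    (hCW : ∃ C : VariableChange ℚ, C • V.quadraticTwist (p : ℚ) = W) (hV : Mult V p)
    (hκ : κ.IsCyclotomic) (hγ : κ.IsTopGenerator γ) (hcv : IsCyclotomicVariable p γ)
    (hf : IsNewformOf V f) (D : W.SelmerDualData κ γ) (ϖ : ℚ)
    (hϖ : (ϖ : ℝ) * V.realPeriodRat = plusPeriod f) :
    ∃ (B : PowerSeries ℚ_[p]) (e : ℤ_[p]ˣ),
      ((V.HasSplitMultiplicativeReductionAtPrime p ∧
          B = padicLFunctionPlusBranchMult f (1 : ℚ_[p]) (p / 2)) ∨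
        (¬ V.HasSplitMultiplicativeReductionAtPrime p ∧
          B = padicLFunctionPlusBranchMult f (-1 : ℚ_[p]) (p / 2))) ∧
      PowerSeries.constantCoeff B = ((e : ℤ_[p]) : ℚ_[p]) * (legendrePlusSymbolSum f p : ℚ_[p]) ∧
      ∃ gK ∈ D.charIdeal, ∃ u : ℤ_[p]ˣ, D.charIdeal = Ideal.span {gK} ∧
        iwasawaToPowerSeries p gK = PowerSeries.C (((u : ℤ_[p]) : ℚ_[p]) * (ϖ : ℚ_[p])) * B :=
  charIdeal_eq_span_wuthrich_of_chiBranchLowerLeadingTerm_rankZero_mult_red hW16 hPal hmod hX.1.2 hr hX.1.1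
    ((missingLowerBoundAt_iff_chiBranchLowerLeadingTermAt_classX3M_rankZero hDel hDelX hPal hGZK hmod hmodD
      hX hp5 hp1 hr).mp hlow) V hp1 hCW hV hκ hγ hcv hf D ϖ hϖ

/-- **From the crux's own conclusion, X3♯(M), odd branch** (`p ≡ 3 (mod 4)`, `p ≥ 5`).
[cite: Wuthrich2014, Thm. 16 (p. 397)] [cite: Delbourgo1998, Prop. 4 (p. 144)] [cite: Miller2011LMS, Def. 1.1] -/
theorem charIdeal_eq_span_wuthrich_of_missingLowerBoundAt_rankZero_mult_red_odd
    (hW16 : Wuthrich2014.thm16_halfEigenCharIdeal_dvd_cyclotomicPrime)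
    (hDel : Delbourgo1998.prop4_rankZero_pow_dvd_constantCoeff)
    (hDelX : Delbourgo1998.prop4_rankZero_constantCoeff_eq_unit_mul_of_potMult)
    (hGZK : rank_eq_analyticRank_of_analyticRank_le_one) (hmod : hasEntireLFunction_rat)
    (hmodD : nonempty_modularParametrizationData)
    (hX : ClassX3M W p) (hp5 : 5 ≤ p) (hp3 : p % 4 = 3) (hr : W.analyticRank = 0)
    (hlow : MissingLowerBoundAt W p)
    (V : WeierstrassCurve ℚ) [V.IsElliptic] [V.IsGloballyMinimal]
    {κ : ZpExtension ℚ p} {γ : Field.absoluteGaloisGroup ℚ} {N : ℕ} [NeZero N]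
    {f : CuspForm (Gamma0 N) 2}
    (hCW : ∃ C : VariableChange ℚ, C • V.quadraticTwist (-(p : ℚ)) = W) (hV : Mult V p)
    (hκ : κ.IsCyclotomic) (hγ : κ.IsTopGenerator γ) (hcv : IsCyclotomicVariable p γ)
    (hf : IsNewformOf V f) (D : W.SelmerDualData κ γ) (ϖ : ℚ)
    (hϖ : (ϖ : ℝ) * V.imaginaryPeriodRat = minusPeriod f) :
    ∃ (B : PowerSeries ℚ_[p]) (e : ℤ_[p]ˣ),
      ((V.HasSplitMultiplicativeReductionAtPrime p ∧
          B = padicLFunctionMinusBranchMult f (1 : ℚ_[p]) (p / 2)) ∨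
        (¬ V.HasSplitMultiplicativeReductionAtPrime p ∧
          B = padicLFunctionMinusBranchMult f (-1 : ℚ_[p]) (p / 2))) ∧
      PowerSeries.constantCoeff B = ((e : ℤ_[p]) : ℚ_[p]) * (legendreMinusSymbolSum f p : ℚ_[p]) ∧
      ∃ gK ∈ D.charIdeal, ∃ u : ℤ_[p]ˣ, D.charIdeal = Ideal.span {gK} ∧
        iwasawaToPowerSeries p gK = PowerSeries.C (((u : ℤ_[p]) : ℚ_[p]) * (ϖ : ℚ_[p])) * B :=
  charIdeal_eq_span_wuthrich_of_chiBranchLowerLeadingTermOdd_rankZero_mult_red hW16 hmod hX.1.2 hr hX.1.1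
    ((missingLowerBoundAt_iff_chiBranchLowerLeadingTermOddAt_classX3M_rankZero hDel hDelX hGZK hmod hmodD
      hX hp5 hp3 hr).mp hlow) V hp3 hCW hV hκ hγ hcv hf D ϖ hϖ

end Summit.BirchSwinnertonDyer.BirchSwinnertonDyer.Theorems.AdditiveBranchIMCMultLowerLambdaAdic

end
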